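import Summits.ResolutionOfSingularities.ResolutionOfSingularities.Theorems.UniversalCellsCampaignW82PrimeFieldTransfer
import Summits.ResolutionOfSingularities.ResolutionOfSingularities.Theorems.UniversalCellsPrimeFieldToPerfectOfFamilyResolutionInsep
import Summits.ResolutionOfSingularities.ResolutionOfSingularities.Theorems.UniformComplexityPrimeModelTransferFamilyResolutionSpreadEmbedding
import Literature.AlgebraicGeometry.Resolution.ResolutionOfComponents
import Summits.ResolutionOfSingularities.ResolutionOfSingularities.Theorems.UniformComplexityCampaignW82FamilyResolutionRungs
import Mathlib.Algebra.CharP.Algebra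
import HarnessLib

/-!
# [OURS · L1 W8.2 door 1] THE CRUX `PrimeFieldToPerfect` IS RESOLUTION IN FAMILIES WITH RADICIAL BASE
# EXTENSIONS OVER `𝔽_p` — «⇒» and by-name links (Theses-cone leaf)

Route `ResolutionOfSingularities/UniversalCells`, crux `PrimeFieldToPerfect`
(stmt-ResolutionOfSingularities-15233: resolution over `Spec (ZMod p)` ⇒ resolution over every perfect field
of characteristic `p`). The OURS module `Theorems/UniversalCellsCampaignW82FamilyResolutionInsep.lean`
(p533235) types the door-1 family form `CampaignW82.FamilyResolutionInsep p k` (simultaneous weak resolution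
of the field-valued fibres of proper families over finitely generated `k`-domains with integral RADICIAL
generic fibre, after a finite-type RADICIAL injective base extension); «⇐» is
`Theorems/UniversalCellsPrimeFieldToPerfectOfFamilyResolutionInsep.lean`
(`PrimeModelTransfer.hasResolution_of_familyResolutionInsep`: family resolution over `k` ⇒ resolution over
every PERFECT `K ⊇ k`). THIS FILE:

* `CampaignW82.familyResolutionInsep_of_integralPerfectRes` — «⇒»: **resolution of the integral separated
  finite-type schemes over ALL perfect fields of characteristic `p` ⇒ `FamilyResolutionInsep p k` for every
  `k` of characteristic `p`** (the spreading theorem WITH EMBEDDING,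
  `PrimeModelTransfer.exists_familyResolution_datum_embedding`, p532724, at the given perfect radicial `L`:
  the produced `A'` embeds into `L` over `A`, hence is radicial);
* `CampaignW82.integralPerfectRes_iff_familyResolutionInsep` — **resolution (integral schemes) over all
  perfect fields of characteristic `p` ↔ `FamilyResolutionInsep p (ZMod p)`**;
* `CampaignW82.perfectRes_iff_familyResolutionInsep` — the same with the REDUCED wording of
  `Theorems.PerfectRes p` (`HironakaBridge.lean`; reduced ⇒ integral by components,
  `Resolution.hasResolution_of_forall_closeds`);
* `CampaignW82.primeFieldTransferAt_iff_familyResolutionInsep` — **the crux slice BY NAME: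
  `PrimeFieldTransferAt p ↔ (resolution of integral schemes over Spec (ZMod p) → FamilyResolutionInsep p (ZMod p))`**;
* `CampaignW82.primeFieldToPerfect_iff_familyResolutionInsep` — for the route declaration
  `Theses.UniversalCells.PrimeFieldToPerfect`;
* `CampaignW82.familyResolution_of_familyResolutionInsep` — the radicial (door-1) family form implies the
  algebraic (door-2) one, `FamilyResolutionInsep p k → FamilyResolution k`.

Reading (slot W8.2, «transfer FAMILIES, not fibres», door 1): resolving over the prime field and
transferring to a perfect field `K` succeeds EXACTLY when `𝔽_p`-families admit, generically on the base and
after a RADICIAL base extension, simultaneous weakly-resolving models with smooth fibres — the radicial base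
extension being the inseparable base change of the barrier files (`InseparableBaseChangeResolution.lean`,
`FrobeniusTwistResolution.lean`, `RegularNotGeometricallyRegular.lean`) along which the REGULAR total space
does not stay regular; compare the door-1 residual of record (`ClimbRatFuncPerf` / the perfection step,
Frobenius-twist normal forms of res-L1-s82-pv-1).

[OURS · LADDER-RESOLUTION L1, slot W8.2 (prime-field / universality transfer), door 1 UniversalCells]
Theorems over the summit's own route and OURS names; NOT statements of, and attributing nothing to,
Hironaka's 2017 manuscript (the OURS `Prop`s replace the role of §17 ¶2, p.89 l.59–62). AI-written; weaker
than expert review. Leaf of the Theses cone (imports `…CampaignW82PrimeFieldTransfer`, which imports the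
route file); nothing imports this file.
-/

noncomputable section

set_option linter.dupNamespace false -- mandated namespace of this single-conjunct summit

open CategoryTheory CategoryTheory.Limits AlgebraicGeometry TopologicalSpace
open Literature.AlgebraicGeometry.Resolution

namespace Summit.ResolutionOfSingularities.ResolutionOfSingularities.Theorems.CampaignW82

/-- A radicial algebra in the sense of `FamilyResolutionInsep` (every `x` satisfies `b · x ^ (p ^ n) = a`,
`b ≠ 0`) is algebraic. [folklore] -/
theorem isAlgebraic_of_radicial {p : ℕ} (hp : p.Prime) {A L : Type} [CommRing A] [Ring L] [Algebra A L]
    (hrad : ∀ x : L, ∃ (n : ℕ) (a b : A), b ≠ 0 ∧ algebraMap A L b * x ^ p ^ n = algebraMap A L a) :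
    Algebra.IsAlgebraic A L := by
  refine ⟨fun x => ?_⟩
  obtain ⟨n, a, b, hb, h⟩ := hrad x
  have hdeg : 0 < p ^ n := pow_pos hp.pos n
  refine ⟨Polynomial.C b * Polynomial.X ^ (p ^ n) - Polynomial.C a, ?_, ?_⟩
  · intro h0
    have h1 := congrArg Polynomial.natDegree h0
    rw [Polynomial.natDegree_sub_eq_left_of_natDegree_lt (by
        rw [Polynomial.natDegree_C, Polynomial.natDegree_C_mul_X_pow _ _ hb]; exact hdeg),
      Polynomial.natDegree_C_mul_X_pow _ _ hb, Polynomial.natDegree_zero] at h1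
    exact hdeg.ne' h1
  · simp [h]

/-- **«⇒»: RESOLUTION OVER ALL PERFECT FIELDS OF CHARACTERISTIC `p` ⇒ RADICIAL FAMILY RESOLUTION over
every field of characteristic `p`.** For a proper family `f : 𝒳 → Spec A` over a finitely generated
`k`-domain and a perfect radicial `L ⊇ A` with `𝒳 ×_A Spec L` integral: `L` has characteristic `p` and is
algebraic over `A`, `𝒳 ×_A Spec L` is proper over `L`, hence resolvable by hypothesis; the spreading
theorem with embedding (`PrimeModelTransfer.exists_familyResolution_datum_embedding`, p532724) yields `A'`,
`G` and an injective `A`-algebra map `e : A' → L`, along which the radicial relations of `L` pull back to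
`A'`. [cite: EGAIV3, Thm. 8.10.5] -/
theorem familyResolutionInsep_of_integralPerfectRes (p : ℕ) [Fact p.Prime]
    (hperf : ∀ (K : Type) [Field K] [CharP K p] [PerfectField K] (X : Scheme.{0})
      (f : X ⟶ Spec (.of K)), IsSeparated f → LocallyOfFiniteType f → QuasiCompact f → IsIntegral X →
        Scheme.HasResolution X)
    (k : Type) [Field k] [CharP k p] : FamilyResolutionInsep p k := by
  intro A _ _ _ hAft 𝒳 f hf hL
  obtain ⟨L, _, _, _, hAL, hrad, hint⟩ := hL
  haveI := hAft
  haveI := hf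
  haveI : IsNoetherianRing A := Algebra.FiniteType.isNoetherianRing k A
  haveI : CharP A p := charP_of_injective_algebraMap (algebraMap k A).injective p
  haveI : CharP L p := charP_of_injective_algebraMap hAL p
  haveI : Algebra.IsAlgebraic A L := isAlgebraic_of_radicial (Fact.out : p.Prime) hrad
  haveI := hint
  have hY : Scheme.HasResolution (pullback f (Spec.map (CommRingCat.ofHom (algebraMap A L)))) :=
    hperf L _ (pullback.snd f _) inferInstance inferInstance inferInstance hint
  obtain ⟨A', _, _, _, hinj, hft, -, ⟨e, he⟩, 𝒴, G, hG⟩ :=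
    PrimeModelTransfer.exists_familyResolution_datum_embedding A L hAL 𝒳 f hint hY
  refine ⟨A', inferInstance, inferInstance, inferInstance, hinj, hft, fun x => ?_, 𝒴, G, hG⟩
  obtain ⟨n, a, b, hb, h⟩ := hrad (e x)
  refine ⟨n, a, b, hb, he ?_⟩
  rw [map_mul, map_pow, e.commutes, e.commutes]
  exact h

/-- **Resolution of integral schemes over all perfect fields of characteristic `p` ⟺ radicial family
resolution over the prime field.** (→ `familyResolutionInsep_of_integralPerfectRes`; ←
`PrimeModelTransfer.hasResolution_of_familyResolutionInsep` with `k = ZMod p ⊆ K`.) [folklore] -/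
theorem integralPerfectRes_iff_familyResolutionInsep (p : ℕ) [Fact p.Prime] :
    (∀ (K : Type) [Field K] [CharP K p] [PerfectField K] (X : Scheme.{0}) (f : X ⟶ Spec (.of K)),
        IsSeparated f → LocallyOfFiniteType f → QuasiCompact f → IsIntegral X → Scheme.HasResolution X) ↔
      FamilyResolutionInsep p (ZMod p) := by
  refine ⟨fun h => familyResolutionInsep_of_integralPerfectRes p h (ZMod p), fun h K _ _ _ X f hs hl hq hX => ?_⟩
  letI : Algebra (ZMod p) K := ZMod.algebra K p
  exact PrimeModelTransfer.hasResolution_of_familyResolutionInsep p (ZMod p) K h X f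

/-- Over a field, resolution of all INTEGRAL separated finite-type schemes gives resolution of all REDUCED
ones (components are integral closed subschemes; glue — tree `Resolution.hasResolution_of_forall_closeds`).
[cite: CossartPiltant2019, proof of Prop. 4.6, Step 1] -/
theorem hasResolution_of_isReduced_of_forall_isIntegral (K : Type) [Field K]
    (h : ∀ (X : Scheme.{0}) (f : X ⟶ Spec (.of K)), IsSeparated f → LocallyOfFiniteType f →
      QuasiCompact f → IsIntegral X → Scheme.HasResolution X)
    (X : Scheme.{0}) (f : X ⟶ Spec (.of K)) [IsSeparated f] [LocallyOfFiniteType f] [QuasiCompact f]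
    [IsReduced X] : Scheme.HasResolution X := by
  refine hasResolution_of_forall_closeds X f fun Z hZ => ?_
  haveI := hZ
  exact h _ ((Scheme.IdealSheafData.vanishingIdeal Z).subschemeι ≫ f) inferInstance inferInstance
    inferInstance hZ

/-- **`PerfectRes p ↔ FamilyResolutionInsep p (ZMod p)`** — with the REDUCED wording of
`Theorems.PerfectRes` (`HironakaBridge.lean`: resolution of every reduced separated finite-type scheme over
every perfect field of characteristic `p`). [folklore] -/
theorem perfectRes_iff_familyResolutionInsep (p : ℕ) [Fact p.Prime] :
    Summit.ResolutionOfSingularities.ResolutionOfSingularities.Theorems.PerfectRes p ↔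
      FamilyResolutionInsep p (ZMod p) := by
  rw [← integralPerfectRes_iff_familyResolutionInsep]
  constructor
  · intro h K _ _ _ X f hs hl hq hX
    haveI := hX
    exact h K X f hs hl hq inferInstance
  · intro h K _ _ _ X f hs hl hq hX
    haveI := hs; haveI := hl; haveI := hq; haveI := hX
    exact hasResolution_of_isReduced_of_forall_isIntegral K (fun Y g hs' hl' hq' hY => h K Y g hs' hl' hq' hY)
      X f

/-- **THE DOOR-1 CRUX SLICE IS RADICIAL FAMILY RESOLUTION OVER THE PRIME FIELD, BY NAME.**
`PrimeFieldTransferAt p` (the `p`-slice of `Theses.UniversalCells.PrimeFieldToPerfect`: resolution of the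
integral separated finite-type schemes over `Spec (ZMod p)` ⇒ resolution of the reduced ones over every
perfect field of characteristic `p`) holds iff resolution over `Spec (ZMod p)` implies
`FamilyResolutionInsep p (ZMod p)`. [folklore] -/
theorem primeFieldTransferAt_iff_familyResolutionInsep (p : ℕ) [Fact p.Prime] :
    PrimeFieldTransferAt p ↔
      ((∀ (X : Scheme.{0}) (f : X ⟶ Spec (.of (ZMod p))),
          IsSeparated f → LocallyOfFiniteType f → QuasiCompact f → IsIntegral X → Scheme.HasResolution X) →
        FamilyResolutionInsep p (ZMod p)) :=
  imp_congr_right fun _ => perfectRes_iff_familyResolutionInsep p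

/-- **For the route declaration.** `Theses.UniversalCells.PrimeFieldToPerfect ↔ ∀ p [Fact p.Prime]`,
resolution over `Spec (ZMod p)` implies `FamilyResolutionInsep p (ZMod p)` (`primeFieldToPerfect_iff`,
p460619, is `Iff.rfl`). [folklore] -/
theorem primeFieldToPerfect_iff_familyResolutionInsep :
    Summit.ResolutionOfSingularities.ResolutionOfSingularities.Theses.UniversalCells.PrimeFieldToPerfect ↔
      ∀ (p : ℕ) [Fact p.Prime],
        (∀ (X : Scheme.{0}) (f : X ⟶ Spec (.of (ZMod p))),
            IsSeparated f → LocallyOfFiniteType f → QuasiCompact f → IsIntegral X →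
              Scheme.HasResolution X) →
          FamilyResolutionInsep p (ZMod p) := by
  rw [primeFieldToPerfect_iff]
  constructor
  · intro h p hp
    exact (primeFieldTransferAt_iff_familyResolutionInsep p).mp (h p hp.out)
  · intro h p hp
    haveI : Fact p.Prime := ⟨hp⟩
    exact (primeFieldTransferAt_iff_familyResolutionInsep p).mpr (h p)


/-- **The radicial family form implies the algebraic one**: `FamilyResolutionInsep p k → FamilyResolution k`
for every field `k` of characteristic `p`. Given a proper family whose geometric generic fibre over
`(Frac A)^{alg}` is integral, its radicial generic fibre over the perfect closure `L` of `Frac A` INSIDE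
`(Frac A)^{alg}` (`PrimeModelTransfer.exists_perfectClosure_inside`) is integral too (flat surjective
descent), so `FamilyResolutionInsep` applies; a radicial extension is algebraic (`isAlgebraic_of_radicial`).
Consistent with `PerfectRes p → AlgClosedRes p` under the two by-name equivalences. [folklore] -/
theorem familyResolution_of_familyResolutionInsep (p : ℕ) [Fact p.Prime] (k : Type) [Field k] [CharP k p]
    (h : FamilyResolutionInsep p k) : FamilyResolution k := by
  intro A _ _ _ hAft 𝒳 f hf hint
  haveI := hAft
  haveI := hf
  haveI : CharP A p := charP_of_injective_algebraMap (algebraMap k A).injective p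
  let K : Type := AlgebraicClosure (FractionRing A)
  obtain ⟨-, hAK⟩ := algebraicClosure_fractionRing_isAlgebraic_injective A
  haveI : CharP K p := charP_of_injective_algebraMap hAK p
  haveI : PerfectField K := IsAlgClosed.perfectField K
  -- the perfect closure `L` of `Frac A` inside `K = (Frac A)^{alg}`
  obtain ⟨L, _, _, _, σ, hAL, hσ, hrad⟩ :=
    PrimeModelTransfer.exists_perfectClosure_inside p (algebraMap A K) hAK
  -- `𝒳 ×_A Spec L` is integral: `𝒳 ×_A Spec K` is its flat surjective base change
  let iL : Spec (.of L) ⟶ Spec (.of A) := Spec.map (CommRingCat.ofHom (algebraMap A L))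
  let iK : Spec (.of K) ⟶ Spec (.of A) := Spec.map (CommRingCat.ofHom (algebraMap A K))
  let jσ : Spec (.of K) ⟶ Spec (.of L) := Spec.map (CommRingCat.ofHom σ)
  have hjσ : jσ ≫ iL = iK := by
    change Spec.map _ ≫ Spec.map _ = Spec.map _
    rw [← Spec.map_comp, ← CommRingCat.ofHom_comp, hσ]
  haveI : IsIntegral (pullback f iK) := hint
  let m : pullback f iK ⟶ pullback f iL :=
    pullback.lift (pullback.fst f iK) (pullback.snd f iK ≫ jσ)
      (by rw [Category.assoc, hjσ]; exact pullback.condition)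
  have hsqm : IsPullback m (pullback.snd f iK) (pullback.snd f iL) jσ := by
    have outer : IsPullback (m ≫ pullback.fst f iL) (pullback.snd f iK) f (jσ ≫ iL) := by
      rw [pullback.lift_fst, hjσ]; exact IsPullback.of_hasPullback f iK
    exact outer.of_right (pullback.lift_snd _ _ _) (IsPullback.of_hasPullback f iL)
  haveI : Subsingleton ↥(Spec (CommRingCat.of L)) := inferInstanceAs (Subsingleton (PrimeSpectrum L))
  haveI : Subsingleton ↥(Spec (CommRingCat.of K)) := inferInstanceAs (Subsingleton (PrimeSpectrum K))
  haveI : Nonempty ↥(Spec (CommRingCat.of K)) := inferInstanceAs (Nonempty (PrimeSpectrum K))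
  haveI : Flat jσ := by
    letI : Algebra L K := σ.toAlgebra
    haveI hflat : Module.Flat L K := inferInstance
    rw [show jσ = Spec.map (CommRingCat.ofHom (algebraMap L K)) from rfl, Flat.SpecMap_iff,
      CommRingCat.hom_ofHom]
    exact RingHom.flat_algebraMap_iff.mpr hflat
  haveI : Surjective jσ := inferInstance
  haveI : Flat m := MorphismProperty.of_isPullback (P := @Flat) hsqm.flip ‹Flat jσ›
  haveI : Surjective m := MorphismProperty.of_isPullback (P := @Surjective) hsqm.flip ‹Surjective jσ›
  haveI : IsReduced (pullback f iL) :=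
    Literature.AlgebraicGeometry.Morphisms.isReduced_of_flat_of_surjective m
  haveI : IrreducibleSpace ↥(pullback f iL) :=
    Function.Surjective.irreducibleSpace m.continuous m.surjective
  have hintL : IsIntegral (pullback f iL) := isIntegral_of_irreducibleSpace_of_isReduced _
  obtain ⟨A', _, _, _, hinj, hft, hradA, 𝒴, G, hG⟩ := h.exists_datum A 𝒳 f L hAL hrad hintL
  exact ⟨A', inferInstance, inferInstance, inferInstance, hinj, hft,
    isAlgebraic_of_radicial (Fact.out : p.Prime) hradA, 𝒴, G, hG⟩

end Summit.ResolutionOfSingularities.ResolutionOfSingularities.Theorems.CampaignW82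

end
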